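import Summits.HodgeConjecture.HodgeConjecture.Theorems.Ring2DeformFrameRows
import Summits.HodgeConjecture.HodgeConjecture.Theorems.Ring2AbelianAllSpreadDominationEigen
import HarnessLib

/-!
# Ring 2 · route `deform`, XIX — the ANDRÉ-1992 rows of parts I / III / XIV RE-BASED on the tree's PROVED André
# reduction: granted ONE eigen-typed anchoring input (spread-1's DA_eig), the deformation inputs (1) `AbelianSchemeVHC`
# and IC_MT make `HC_CM` idle with NO André-1992 fact, NO tensor-anchored Weil families and NO open leaf R3anc

HONEST FRAMING: research route conditional on HC_CM; not a corollary; Q11.4-sentence-2 already refuted in dim ≥ 3.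

Cell `pub-hodge-ring2`, seat `pub-hodge-ring2-deform` (gen 51), supporting the OPEN item `CMToAbelian`
(stmt-HodgeConjecture-16267; nothing here closes it). `HC_CM` := the binder `Theses.RankFourFaces.CMAbelianHodge`
(always an argument, never a fact); `HC_AV` := `Theses.PadicSemiregularLift.HodgeAbelianVarieties`.

WHY THIS PART (standing rule D.163 (γ) of the seat, fired by spread-1's part X `Ring2AbelianAllSpreadDominationEigen`).
Parts I (rows (D), (M), (E₂), (E₃)), III (row M) and XIV (§A `cmIdle_abelianSchemeVHC_of_milne`, §B
`cmIdle_invariantCyclesOnMTFamilies_of_aoDense_of_denselyAnchored`, §P the two pivots) reach `HC_CM` from a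
deformation input through the FIELD-typed Weil rungs, hence bind André's 1992 theorem as the UNDISCHARGED named fact
`h𝔄 : Andre1992_hodgeClasses_cmAbelianVariety_mem_span_pullback_weilClasses` (+ Deligne's tensor-anchored Weil
families `deligne1982_weilFamily_hodgeWeilSection_all` and hweil's OPEN anchored leaf R3anc `AnchoredWeilFamiliesCMField`,
or spread-1's two field-typed anchoring inputs DA_q, DA_K). Meanwhile the tree PROVES André's reduction in EIGEN-typed
form (crux line `cm-pivot-andre`: `HC_CM ↔ W_eig`, kernel-checked, no fact), and spread-1's part X supplies the hooks
`HC_CM_of_denselyAnchoredEigen_of_spreadZD` (D_eig: `DA_eig → S_ZD → HC_CM`, NO Literature binder) and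
`cmIdle_spreadZD_of_denselyAnchoredEigen` (frame row, `hF` only). This part threads those hooks through the deformation
axis's own rows. Ledger, row by row (binders other than the deformation input itself):

* (D)  `HC_CM_of_abelianSchemeVHC`            [h𝔄, hD_fam, R3anc]        ↦ (D′)  [DA_eig]            — NO named fact
* (M)  `HC_AV_of_abelianSchemeVHC` / III row M / XIV §A [h𝔄, hD_fam, R3anc, MTAnchors | h₁₄] ↦ (M′) [hF, DA_eig]
* (E₂) `HC_AV_iff_abelianSchemeVHC`           [h𝔄, hD_fam, R3anc, MTAnchors] ↦ (E₂′) [hF, DA_eig]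
* (E₃) `HC_CM_and_abelianSchemeVHC_iff`       [h𝔄, hD_fam, R3anc]        ↦ (E₃′) [DA_eig]            — NO named fact
* XIV §B `CMIdle IC_MT`                       [AO⁺, hF, h𝔄, DA_q, DA_K]  ↦ §2    [AO⁺, hF, DA_eig]
* XIV §P `PivotAV IC_MT`, `PivotAV (1)`        (same lists)               ↦ §1/§2 [hF, DA_eig] (+ AO⁺ for IC_MT)
* NEW: (D′_MT) `IC_MT → HC_CM` granted [AO⁺, DA_eig], no fact; residual exactness `DA_eig ↔ HC_CM` granted (1) ∧ hF,
  resp. granted IC_MT ∧ AO⁺ ∧ hF.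

COUNT ONCE. The arrow `W_eig ⟹ HC_CM` is crux line `cm-pivot-andre`'s theorem; DA_eig, (D_eig) and the re-based frame
row are spread-1's (part X); `(1) ⟹ S_ZD` is spread I, `IC_MT ⟹[AO⁺] S_ZD` is XIV §B. New here is ONLY the threading
through the deformation axis's rows, the IC_MT rows (a deform-displayed node) and the two residual-exactness rows;
every proof is a composition BY NAME. Parts I / III / XIV are untouched: their field-typed rows stand as filed (they
and the rows below have INCOMPARABLE hypothesis sets as typed — §3 records the one comparison that holds).

HONEST COLUMN. DA_eig (`DenselyAnchoredEigenWeilClassesCM`) is an OPEN `@[conjecture]` node of spread-1, on-path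
(`HC_CM ⟹ DA_eig` mod `hF`) and, granted (1) and `hF`, EXACTLY `HC_CM` (§1) — so the KIND of every row is unchanged
(open-node-conditional); what changed is the FACT LEDGER: André 1992 is BYPASSED (not discharged — `h𝔄` has no
`_holds` in the tree), Deligne's Thm. 4.8 families and the open leaf R3anc leave, and rows (D′), (E₃′), (D′_MT) bind
no Literature fact at all. AO⁺ (`ZariskiDenseCMLocusIsDense`, André–Oort-type) is NOT a consequence of HC and is not
claimed on-path. IC_MT is DISPLAYED INLINE exactly as in parts III / XIV (no `def`, no notation).

References (bib keys): Andre1992HodgeCM (Théorème); Deligne1982HodgeCycles (Prop. 6.1, Thm. 4.8; Milne 2003 re-edition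
endnote 19); CharlesSchnell2014Notes (Conj. 11.3.1, Cor. 11.3.6, Thm. 11.5.11); Abdulali1994FamiliesAV ((1.1), Lemma
6.2, Thm. 6.1 (a)); Andre1996Motifs (§6.3 Lemme 6.3.3, Remarque 2); Pila2022 (Conj. 6.4, Thm. 6.6).
-/

noncomputable section

set_option linter.dupNamespace false

namespace Summit.HodgeConjecture.HodgeConjecture.Ring2.Deform

open CategoryTheory AlgebraicGeometry
open Literature.AlgebraicGeometry Literature.AlgebraicGeometry.Motives
open Literature.AlgebraicGeometry.HodgeTheory
open Literature.AlgebraicGeometry.Abdulali1994 (InvariantCyclesHoldFor)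
open Literature.AlgebraicGeometry.Deligne1982 (deligne1982_cmDenseMumfordTateFamilies IsCMDenseMumfordTateFamilyFor)
open Summit.HodgeConjecture.HodgeConjecture
open Summit.HodgeConjecture.HodgeConjecture.WeilTypeLadder (AnchoredWeilFamiliesCMField)
open Summit.HodgeConjecture.HodgeConjecture.Theses
open Summit.HodgeConjecture.HodgeConjecture.Theses.RankFourFaces (CMAbelianHodge CMToAbelian)
open Summit.HodgeConjecture.HodgeConjecture.Theses.PadicSemiregularLift (HodgeAbelianVarieties)
open Summit.HodgeConjecture.HodgeConjecture.Ring2.Hypotheses (AbelianSchemeVHC)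
open Summit.HodgeConjecture.HodgeConjecture.Ring2.AbelianAll (OnPathAV ExactWithCM CMIdle PivotAV
  cmIdle_antitone iff_of_pivotAV exactWithCM_of_pivotAV SpreadFromZariskiDenseCMPoints ZariskiDenseCMLocusIsDense
  CMWeilEigenClassesAlgebraic DenselyAnchoredEigenWeilClassesCM
  spreadFromZariskiDenseCMPoints_of_abelianSchemeVHC spreadFromZariskiDenseCMPoints_of_HC_AV
  onPathAV_abelianSchemeVHC_and_compactAbelianPencilVHC
  cmWeilEigenClassesAlgebraic_of_denselyAnchoredEigen_of_spreadZD HC_CM_of_denselyAnchoredEigen_of_spreadZD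
  cmIdle_spreadZD_of_denselyAnchoredEigen cmIdle_abelianSchemeVHC_of_denselyAnchoredEigen
  denselyAnchoredEigen_of_deligne1982_of_HC_CM denselyAnchoredEigen_of_deligne1982_of_HC_AV
  denselyAnchoredEigen_iff_HC_CM_of_spreadZD)

/-! IC_MT below = Grothendieck's invariant-cycles statement (1.1) on every family satisfying the printed predicate
`IsCMDenseMumfordTateFamilyFor A p c`, DISPLAYED INLINE exactly as in parts III / XIV (no `def`, no notation):
`∀ A p c 𝒳 S f, IsCMDenseMumfordTateFamilyFor A p c f → InvariantCyclesHoldFor f A.dim`.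
[cite: Abdulali1994FamiliesAV, (1.1) (p. 1122) and Lemma 6.2 (p. 1131)] -/

/-! ## §1 The blanket-VHC rows of part I re-based: (1) `AbelianSchemeVHC` and ONE eigen-typed anchoring input -/

/-- **(D′) row I (D) re-based — `HC_CM` from VHC for abelian schemes granted DA_eig, with NO Literature binder**
(I (D) `HC_CM_of_abelianSchemeVHC` binds `h𝔄`, Deligne's Thm. 4.8 families and the open leaf R3anc). Proof:
`(1) ⟹ S_ZD` (spread I) ⟹ W_eig (spread X) ⟹ `HC_CM` (the tree's proved André reduction).
[cite: CharlesSchnell2014Notes, Conj. 11.3.1] [cite: Andre1992HodgeCM, Théorème] -/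
theorem HC_CM_of_denselyAnchoredEigen_of_abelianSchemeVHC (hD : DenselyAnchoredEigenWeilClassesCM)
    (hV : AbelianSchemeVHC) : CMAbelianHodge :=
  HC_CM_of_denselyAnchoredEigen_of_spreadZD hD (spreadFromZariskiDenseCMPoints_of_abelianSchemeVHC hV)

/-- The intermediate node made visible on the deformation axis: (1) and DA_eig give the eigen-typed CM Weil-class
algebraicity W_eig of crux line `cm-pivot-andre` (fact-free). [cite: CharlesSchnell2014Notes, Conj. 11.3.1] -/
theorem cmWeilEigenClassesAlgebraic_of_denselyAnchoredEigen_of_abelianSchemeVHC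
    (hD : DenselyAnchoredEigenWeilClassesCM) (hV : AbelianSchemeVHC) : CMWeilEigenClassesAlgebraic :=
  cmWeilEigenClassesAlgebraic_of_denselyAnchoredEigen_of_spreadZD hD
    (spreadFromZariskiDenseCMPoints_of_abelianSchemeVHC hV)

/-- **(M′) rows I (M) / III row M / XIV §A re-based — Milne's endnote-19 theorem `VHC ⟹ HC_AV` granted `hF` and
DA_eig only** (I (M): `h𝔄`, Thm. 4.8 families, R3anc, `MTAnchors`; XIV §A: the same with `h₁₄`). This IS spread X's
`cmIdle_abelianSchemeVHC_of_denselyAnchoredEigen` BY NAME (count once: theirs), displayed as the deformation axis's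
fourth kernel path to `CMIdle (1)`. [cite: Deligne1982HodgeCycles, Prop. 6.1 and Milne 2003 re-edition endnote 19] -/
theorem HC_AV_of_deligne1982_of_denselyAnchoredEigen_of_abelianSchemeVHC
    (hF : deligne1982_cmDenseMumfordTateFamilies) (hD : DenselyAnchoredEigenWeilClassesCM)
    (hV : AbelianSchemeVHC) : HodgeAbelianVarieties :=
  cmIdle_abelianSchemeVHC_of_denselyAnchoredEigen hF hD hV

/-- **(E₂′) `HC_AV ↔ AbelianSchemeVHC` granted `hF` and DA_eig** (I (E₂): `h𝔄`, Thm. 4.8 families, R3anc,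
`MTAnchors`): VHC for abelian schemes is EXACTLY Hodge for abelian varieties, and neither `HC_CM` nor André 1992
appears. [cite: CharlesSchnell2014Notes, Cor. 11.3.6 (p. 494)] [cite: Deligne1982HodgeCycles, Prop. 6.1] -/
theorem HC_AV_iff_abelianSchemeVHC_of_deligne1982_of_denselyAnchoredEigen
    (hF : deligne1982_cmDenseMumfordTateFamilies) (hD : DenselyAnchoredEigenWeilClassesCM) :
    HodgeAbelianVarieties ↔ AbelianSchemeVHC :=
  ⟨Hypotheses.abelianSchemeVHC_of_hc_av, cmIdle_abelianSchemeVHC_of_denselyAnchoredEigen hF hD⟩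

/-- **(E₃′) what `HC_CM` is worth next to blanket VHC: nothing — `(HC_CM ∧ (1)) ↔ (1)` granted DA_eig ALONE, no
Literature binder** (I (E₃): `h𝔄`, Thm. 4.8 families, R3anc). [cite: Andre1996Motifs, §6.3 Remarque 2 (printed p. 33)]
[cite: Andre1992HodgeCM, Théorème] -/
theorem HC_CM_and_abelianSchemeVHC_iff_of_denselyAnchoredEigen (hD : DenselyAnchoredEigenWeilClassesCM) :
    (CMAbelianHodge ∧ AbelianSchemeVHC) ↔ AbelianSchemeVHC :=
  ⟨fun h ↦ h.2, fun hV ↦ ⟨HC_CM_of_denselyAnchoredEigen_of_abelianSchemeVHC hD hV, hV⟩⟩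

/-- **XIV §P re-based: S_ZD and (1) are PIVOTS granted `hF` and DA_eig** (frame III `pivotAV_spreadZD_of_denselyAnchored`:
`hF`, `h𝔄`, DA_q, DA_K; XIV `pivotAV_abelianSchemeVHC_of_milne`: `h𝔄`, Thm. 4.8 families, R3anc, `h₁₄`).
[cite: Deligne1982HodgeCycles, Prop. 6.1] [cite: CharlesSchnell2014Notes, Conj. 11.3.1 and Cor. 11.3.6] -/
theorem pivotAV_spreadZD_and_abelianSchemeVHC_of_deligne1982_of_denselyAnchoredEigen
    (hF : deligne1982_cmDenseMumfordTateFamilies) (hD : DenselyAnchoredEigenWeilClassesCM) :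
    PivotAV SpreadFromZariskiDenseCMPoints ∧ PivotAV AbelianSchemeVHC :=
  ⟨⟨cmIdle_spreadZD_of_denselyAnchoredEigen hF hD, spreadFromZariskiDenseCMPoints_of_HC_AV⟩,
    ⟨cmIdle_abelianSchemeVHC_of_denselyAnchoredEigen hF hD, onPathAV_abelianSchemeVHC_and_compactAbelianPencilVHC.1⟩⟩

/-- Hence (1) is an EXACT complement in the LEAD grammar granted `hF` and DA_eig: `HC_AV ↔ (HC_CM ∧ (1))` — with the
`HC_CM` conjunct idle by (E₃′). [cite: Deligne1982HodgeCycles, Prop. 6.1] -/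
theorem exactWithCM_abelianSchemeVHC_of_deligne1982_of_denselyAnchoredEigen
    (hF : deligne1982_cmDenseMumfordTateFamilies) (hD : DenselyAnchoredEigenWeilClassesCM) :
    ExactWithCM AbelianSchemeVHC :=
  exactWithCM_of_pivotAV (pivotAV_spreadZD_and_abelianSchemeVHC_of_deligne1982_of_denselyAnchoredEigen hF hD).2

/-- **RESIDUAL EXACTNESS on the VHC branch: granted (1) and `hF`, DA_eig ↔ HC_CM** — once VHC for abelian schemes is
granted, the eigen-typed anchoring input is neither more nor less than Hodge-for-CM (spread X
`denselyAnchoredEigen_iff_HC_CM_of_spreadZD` above `(1) ⟹ S_ZD`). This is the honest residue of "conditional on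
HC_CM" for the blanket-VHC route after the re-base. [cite: Deligne1982HodgeCycles, Prop. 6.1] [cite: Andre1992HodgeCM, Théorème] -/
theorem denselyAnchoredEigen_iff_HC_CM_of_deligne1982_of_abelianSchemeVHC
    (hF : deligne1982_cmDenseMumfordTateFamilies) (hV : AbelianSchemeVHC) :
    DenselyAnchoredEigenWeilClassesCM ↔ CMAbelianHodge :=
  denselyAnchoredEigen_iff_HC_CM_of_spreadZD hF (spreadFromZariskiDenseCMPoints_of_abelianSchemeVHC hV)

/-! ## §2 The Mumford–Tate-branch rows of XIV re-based: IC_MT, AO⁺ and ONE eigen-typed anchoring input -/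

/-- **(D′_MT) NEW ROW — `HC_CM` from invariant cycles on the printed Mumford–Tate families, granted AO⁺ and DA_eig,
with NO Literature binder**: `IC_MT ⟹[AO⁺] S_ZD` (XIV §B) then (D_eig). Before this part the axis had no arrow
`IC_MT → HC_CM` at all (XIV: `ClosesWithCM IC_MT` needs `HC_CM` as INPUT). [cite: Abdulali1994FamiliesAV, (1.1) (p. 1122)]
[cite: Pila2022, Conj. 6.4 and Thm. 6.6] [cite: Andre1992HodgeCM, Théorème] -/
theorem HC_CM_of_denselyAnchoredEigen_of_aoDense_of_invariantCyclesOnMTFamilies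
    (hAO : ZariskiDenseCMLocusIsDense) (hD : DenselyAnchoredEigenWeilClassesCM)
    (hIC : ∀ (A : AbelianVariety ℂ) (p : ℕ) (c : complexBetti A.X (2 * p)) (𝒳 S : SchemeOver ℂ) (f : 𝒳 ⟶ S),
      IsCMDenseMumfordTateFamilyFor A p c f → InvariantCyclesHoldFor f A.dim) : CMAbelianHodge :=
  HC_CM_of_denselyAnchoredEigen_of_spreadZD hD
    (spreadFromZariskiDenseCMPoints_of_aoDense_of_invariantCyclesOnMTFamilies hAO hIC)

/-- **XIV §B re-based — `HC_CM` is IDLE next to IC_MT granted AO⁺, `hF` and DA_eig** (XIV: AO⁺, `hF`, `h𝔄`, DA_q,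
DA_K): the kernel shadow of Abdulali's Thm. 6.1 (a) with André 1992 bypassed. [cite: Abdulali1994FamiliesAV, Thm. 6.1 (a)]
[cite: Deligne1982HodgeCycles, Prop. 6.1] -/
theorem cmIdle_invariantCyclesOnMTFamilies_of_aoDense_of_denselyAnchoredEigen (hAO : ZariskiDenseCMLocusIsDense)
    (hF : deligne1982_cmDenseMumfordTateFamilies) (hD : DenselyAnchoredEigenWeilClassesCM) :
    CMIdle
      (∀ (A : AbelianVariety ℂ) (p : ℕ) (c : complexBetti A.X (2 * p)) (𝒳 S : SchemeOver ℂ) (f : 𝒳 ⟶ S),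
        IsCMDenseMumfordTateFamilyFor A p c f → InvariantCyclesHoldFor f A.dim) :=
  cmIdle_antitone (spreadFromZariskiDenseCMPoints_of_aoDense_of_invariantCyclesOnMTFamilies hAO)
    (cmIdle_spreadZD_of_denselyAnchoredEigen hF hD)

/-- **XIV §P re-based — IC_MT is a PIVOT granted AO⁺, `hF`, DA_eig** (§2 `CMIdle` + XIV §A `OnPathAV`, no fact).
[cite: Abdulali1994FamiliesAV, Thm. 6.1 (a)] [cite: CharlesSchnell2014Notes, Cor. 11.3.6 (p. 494)] -/
theorem pivotAV_invariantCyclesOnMTFamilies_of_aoDense_of_denselyAnchoredEigen (hAO : ZariskiDenseCMLocusIsDense)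
    (hF : deligne1982_cmDenseMumfordTateFamilies) (hD : DenselyAnchoredEigenWeilClassesCM) :
    PivotAV
      (∀ (A : AbelianVariety ℂ) (p : ℕ) (c : complexBetti A.X (2 * p)) (𝒳 S : SchemeOver ℂ) (f : 𝒳 ⟶ S),
        IsCMDenseMumfordTateFamilyFor A p c f → InvariantCyclesHoldFor f A.dim) :=
  ⟨cmIdle_invariantCyclesOnMTFamilies_of_aoDense_of_denselyAnchoredEigen hAO hF hD,
    onPathAV_invariantCyclesOnMTFamilies⟩

/-- **The Mumford–Tate branch COLLAPSES to one statement granted AO⁺, `hF`, DA_eig — `IC_MT ↔ S_ZD ↔ (1) ↔ HC_AV`,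
NO `HC_CM`, NO André 1992** (XIV's reading needed `h𝔄`, DA_q, DA_K): frame III `iff_of_pivotAV` on the three pivots.
[cite: Abdulali1994FamiliesAV, Thm. 6.1 (a)] [cite: CharlesSchnell2014Notes, Conj. 11.3.1 and Cor. 11.3.6]
[cite: Pila2022, Conj. 6.4] -/
theorem mumfordTateBranch_iff_of_aoDense_of_deligne1982_of_denselyAnchoredEigen (hAO : ZariskiDenseCMLocusIsDense)
    (hF : deligne1982_cmDenseMumfordTateFamilies) (hD : DenselyAnchoredEigenWeilClassesCM) :
    ((∀ (A : AbelianVariety ℂ) (p : ℕ) (c : complexBetti A.X (2 * p)) (𝒳 S : SchemeOver ℂ) (f : 𝒳 ⟶ S),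
        IsCMDenseMumfordTateFamilyFor A p c f → InvariantCyclesHoldFor f A.dim) ↔ SpreadFromZariskiDenseCMPoints) ∧
      (SpreadFromZariskiDenseCMPoints ↔ AbelianSchemeVHC) ∧ (AbelianSchemeVHC ↔ HodgeAbelianVarieties) :=
  have hP := pivotAV_spreadZD_and_abelianSchemeVHC_of_deligne1982_of_denselyAnchoredEigen hF hD
  ⟨iff_of_pivotAV (pivotAV_invariantCyclesOnMTFamilies_of_aoDense_of_denselyAnchoredEigen hAO hF hD) hP.1,
    iff_of_pivotAV hP.1 hP.2, (HC_AV_iff_abelianSchemeVHC_of_deligne1982_of_denselyAnchoredEigen hF hD).symm⟩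

/-- **RESIDUAL EXACTNESS on the Mumford–Tate branch: granted IC_MT, AO⁺ and `hF`, DA_eig ↔ HC_CM.**
[cite: Abdulali1994FamiliesAV, (1.1) and Lemma 6.2] [cite: Deligne1982HodgeCycles, Prop. 6.1] -/
theorem denselyAnchoredEigen_iff_HC_CM_of_deligne1982_of_aoDense_of_invariantCyclesOnMTFamilies
    (hF : deligne1982_cmDenseMumfordTateFamilies) (hAO : ZariskiDenseCMLocusIsDense)
    (hIC : ∀ (A : AbelianVariety ℂ) (p : ℕ) (c : complexBetti A.X (2 * p)) (𝒳 S : SchemeOver ℂ) (f : 𝒳 ⟶ S),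
      IsCMDenseMumfordTateFamilyFor A p c f → InvariantCyclesHoldFor f A.dim) :
    DenselyAnchoredEigenWeilClassesCM ↔ CMAbelianHodge :=
  denselyAnchoredEigen_iff_HC_CM_of_spreadZD hF
    (spreadFromZariskiDenseCMPoints_of_aoDense_of_invariantCyclesOnMTFamilies hAO hIC)

/-! ## §3 What the re-base costs: the one comparison between the old and the new hypothesis sets that holds -/

/-- **Part I's field-typed inputs IMPLY the eigen-typed input, at the price of André 1992 and `hF`, granted (1)**:
`[h𝔄, Thm. 4.8 families, R3anc] ⟹ DA_eig` (through `HC_CM` by I (D), then spread X on-path). So (D′) is the WEAKER-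
hypothesis form of (D) modulo `[h𝔄, hF]`; the converse comparison is not claimed (as typed the two hypothesis sets are
incomparable: different carriers and eigenvalue fields, cf. spread X `denselyAnchoredEigen_of_denselyAnchoredWeil_of_spreadZD`).
[cite: Andre1992HodgeCM, Théorème] [cite: Deligne1982HodgeCycles, Thm. 4.8 and Prop. 6.1]
[cite: Andre1996Motifs, §6.3 Lemme 6.3.3] -/
theorem denselyAnchoredEigen_of_andre_of_rungInputs_of_abelianSchemeVHC (hF : deligne1982_cmDenseMumfordTateFamilies)
    (h𝔄 : Andre1992_hodgeClasses_cmAbelianVariety_mem_span_pullback_weilClasses)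
    (hDfam : deligne1982_weilFamily_hodgeWeilSection_all) (hanc : AnchoredWeilFamiliesCMField)
    (hV : AbelianSchemeVHC) : DenselyAnchoredEigenWeilClassesCM :=
  denselyAnchoredEigen_of_deligne1982_of_HC_CM hF (HC_CM_of_abelianSchemeVHC h𝔄 hDfam hanc hV)

/-! ## §4 On-path: every binder of this part except AO⁺ is a consequence of the Hodge conjecture (mod `hF` for DA_eig) -/

/-- ON-PATH for the inputs of §1–§2 by name: DA_eig (spread X, mod `hF`), (1) (typer2), IC_MT (III), S_ZD (spread I)
all follow from `HodgeConjecture` through `HC_AV`; AO⁺ is André–Oort-type and is NOT claimed. Listed so that every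
binder is visibly no stronger than HC and `#print axioms` shows the three standard axioms. [folklore] -/
theorem andreRebasedRows_inputs_of_deligne1982_of_hodgeConjecture (hF : deligne1982_cmDenseMumfordTateFamilies)
    (h : _root_.HodgeConjecture) :
    DenselyAnchoredEigenWeilClassesCM ∧ AbelianSchemeVHC ∧
      (∀ (A : AbelianVariety ℂ) (p : ℕ) (c : complexBetti A.X (2 * p)) (𝒳 S : SchemeOver ℂ) (f : 𝒳 ⟶ S),
        IsCMDenseMumfordTateFamilyFor A p c f → InvariantCyclesHoldFor f A.dim) ∧
      SpreadFromZariskiDenseCMPoints :=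
  have hAV : HodgeAbelianVarieties := HC_AV_of_hodgeConjecture h
  ⟨denselyAnchoredEigen_of_deligne1982_of_HC_AV hF hAV, Hypotheses.abelianSchemeVHC_of_hc_av hAV,
    onPathAV_invariantCyclesOnMTFamilies hAV, spreadFromZariskiDenseCMPoints_of_HC_AV hAV⟩

#print axioms Summit.HodgeConjecture.HodgeConjecture.Ring2.Deform.HC_CM_of_denselyAnchoredEigen_of_abelianSchemeVHC
#print axioms Summit.HodgeConjecture.HodgeConjecture.Ring2.Deform.HC_AV_iff_abelianSchemeVHC_of_deligne1982_of_denselyAnchoredEigen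
#print axioms Summit.HodgeConjecture.HodgeConjecture.Ring2.Deform.HC_CM_of_denselyAnchoredEigen_of_aoDense_of_invariantCyclesOnMTFamilies
#print axioms Summit.HodgeConjecture.HodgeConjecture.Ring2.Deform.mumfordTateBranch_iff_of_aoDense_of_deligne1982_of_denselyAnchoredEigen

end Summit.HodgeConjecture.HodgeConjecture.Ring2.Deform

end
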